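import Mathlib
import Summits.Ventures.PercRepro2.Defs
import Summits.Ventures.PercRepro2.Graph
import Summits.Ventures.PercRepro2.OneColourSwitch
import Summits.Ventures.PercRepro2.M9NoPocketDefs
import Summits.Ventures.PercRepro2.M9PocketRSEdgeTransfer

/-!
# Edges inside `{r, s}` of a restriction (blind cell PercRepro2, p3 g42, 2026-08-30;
`proofs/P3-POCKETRK.md` §10⁶: a hypothesis transfer for the cluster theorem)

An edge of a restriction of `G` (to a predicate on the edges) that lies inside `{r, s}` is an
edge of `G` inside `{r, s}`; so «no edge inside `{r, s}`» passes from `G` to every restriction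
(`within_restrict_rs_eq_empty`) — the hypothesis `hrs` of `dSignSum_nonpos_of_cluster_rsd`
may be stated on `G`.  Own work; std axioms.
-/

namespace Summit.Ventures.PercRepro2

namespace NoPocket

variable {V : Type*} {E : Type*} {ends : E → Sym2 V} {r s : V}

/-- **No edge inside `{r, s}` passes to a restriction.** -/
lemma within_restrict_rs_eq_empty (P : E → Prop) (hrs : within ends ({r, s} : Set V) = ∅) :
    within (fun e : {e // P e} => ends e.1) ({r, s} : Set V) = ∅ := by
  ext e
  simp only [Set.mem_empty_iff_false, iff_false]
  rintro ⟨x, hx, y, hy, hxy⟩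
  have : e.1 ∈ within ends ({r, s} : Set V) := ⟨x, hx, y, hy, hxy⟩
  rw [hrs] at this
  exact this

end NoPocket

end Summit.Ventures.PercRepro2
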